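import Summits.Schanuel.Schanuel.Theses.TateNomes
import Literature.Barriers.Schanuel.NesterenkoModularScopeValuesProofs
import Literature.NumberTheory.ModularForms.QuasimodularPhi
import Literature.NumberTheory.ModularForms.Lemma49Plus8
import Literature.NumberTheory.Transcendental.OneMotiveToric

/-!
# `TateLocusGPCOne` (crux stmt-Schanuel-17406, route `TateNomes`): the two-nome (S-partner) transfer

Crux `Summit.Schanuel.Schanuel.Theses.TateNomes.TateLocusGPCOne`: for `Im τ > 0`, `τ` not a root of a
monic rational quadratic, `5 ≤ trdeg_ℚ ℚ(2πi, τ, q, P(q), Q(q), R(q))`, `q = e^{2πiτ}` (`P, Q, R`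
Ramanujan's `q`-series, written inline in the route file; definitionally
`Literature.Barriers.Schanuel.ramanujanP/Q/R`).

This helper file (line `Sketch` of the crux, cards `Cruxes/TateLocusGPCOne/Ideas/s-dual-second-cusp.md`
and `fricke-partner-nome.md`) records, sorry-free, the S-DECODER of the crux's two cusp-invisible
generators `τ, 2πi` through the partner nome `q' = e^{2πi(−1/τ)}` of the same lattice `ℤ + τℤ`:

* `ramanujanP_partner`, `ramanujanQ_partner`, `ramanujanR_partner` — `P(q') = τ²P(q) + 12τ/(2πi)`,
  `Q(q') = τ⁴Q(q)`, `R(q') = τ⁶R(q)` (the level-one laws `E2_S_smul`, `E₄_S_smul`, `E₆_S_smul` of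
  the tree read through `ramanujanP/Q/R_cexp`);
* `adjoin_twoNome_le` — the eight cusp-values `(q, P, Q, R)(q) ∪ (q, P, Q, R)(q')` lie in
  `ℚ(2πi, τ, q, P, Q, R)(q')`;
* `trdeg_twoNome_le` — hence `trdeg ℚ(eight) ≤ trdeg ℚ(2πi, τ, q, P, Q, R) + 1`
  (`Literature.NumberTheory.Transcendental.trdeg_adjoin_insert_le`);
* `tateLocusGPCOne_of_twoNome` — the TRANSFER: the pure-nome statement "`6 ≤ trdeg ℚ(eight)` for
  every non-quadratic `τ ∈ ℍ`" (GPC, `dim G_mot = 6`, for `h¹(E_τ) ⊕ [ℤ² → 𝔾_m; (q, q')]`; OPEN,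
  strictly stronger than the crux) implies `TateLocusGPCOne`.  It is a conditional bridge: it closes
  nothing by itself (the hypothesis is the line's registered stub `stub_twoNomeS`).

No new definitions; all sets are written as literals over `ramanujanP/Q/R` and `cexp`.
-/

noncomputable section

-- single-conjunct summit: `Summit.Schanuel.Schanuel.…` repeats the name by the D-0017 layout
set_option linter.dupNamespace false

open Complex IntermediateField
open UpperHalfPlane hiding I
open scoped Real MatrixGroups
open Literature.Barriers.Schanuel (ramanujanP ramanujanQ ramanujanR ramanujanP_cexp ramanujanQ_cexp
  ramanujanR_cexp)
open Literature.NumberTheory.ModularForms (E2_S_smul E₄_S_smul E₆_S_smul coe_S_smul)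

namespace Summit.Schanuel.Schanuel.Theorems.TateNomesTateLocusGPCOne

/-! ## The S-decoder: values at the partner nome `q' = e^{2πi(−1/τ)}` -/

/-- **`P(q') = τ²P(q) + 12τ/(2πi)`** (`E₂(−1/τ) = τ²E₂(τ) − 6iτ/π`, CKMRV (2.4), tree `E2_S_smul`,
read through `P(e^{2πiτ}) = E₂(τ)`). -/
theorem ramanujanP_partner (τ : ℍ) :
    ramanujanP (cexp (2 * π * I * (-(τ : ℂ)⁻¹))) =
      (τ : ℂ) ^ 2 * ramanujanP (cexp (2 * π * I * τ)) + 12 * (τ : ℂ) * (2 * (π : ℂ) * I)⁻¹ := by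
  rw [← coe_S_smul, ramanujanP_cexp, ramanujanP_cexp, E2_S_smul]
  have hπ : (π : ℂ) ≠ 0 := ofReal_ne_zero.2 Real.pi_ne_zero
  have hI : (I : ℂ) ≠ 0 := I_ne_zero
  field_simp
  ring_nf
  rw [I_sq]
  ring

/-- **`Q(q') = τ⁴Q(q)`** (`E₄(−1/τ) = τ⁴E₄(τ)`, tree `E₄_S_smul`). -/
theorem ramanujanQ_partner (τ : ℍ) :
    ramanujanQ (cexp (2 * π * I * (-(τ : ℂ)⁻¹))) = (τ : ℂ) ^ 4 * ramanujanQ (cexp (2 * π * I * τ)) := by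
  rw [← coe_S_smul, ramanujanQ_cexp, ramanujanQ_cexp, E₄_S_smul]

/-- **`R(q') = τ⁶R(q)`** (`E₆(−1/τ) = τ⁶E₆(τ)`, tree `E₆_S_smul`). -/
theorem ramanujanR_partner (τ : ℍ) :
    ramanujanR (cexp (2 * π * I * (-(τ : ℂ)⁻¹))) = (τ : ℂ) ^ 6 * ramanujanR (cexp (2 * π * I * τ)) := by
  rw [← coe_S_smul, ramanujanR_cexp, ramanujanR_cexp, E₆_S_smul]

/-! ## The eight cusp-values lie in the crux field with `q'` adjoined -/

/-- **Decoder inclusion**: `ℚ(q, P, Q, R, q', P', Q', R') ≤ ℚ(2πi, τ, q, P, Q, R)(q')`. -/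
theorem adjoin_twoNome_le (τ : ℍ) :
    adjoin ℚ ({cexp (2 * π * I * τ), ramanujanP (cexp (2 * π * I * τ)),
        ramanujanQ (cexp (2 * π * I * τ)), ramanujanR (cexp (2 * π * I * τ)),
        cexp (2 * π * I * (-(τ : ℂ)⁻¹)), ramanujanP (cexp (2 * π * I * (-(τ : ℂ)⁻¹))),
        ramanujanQ (cexp (2 * π * I * (-(τ : ℂ)⁻¹))), ramanujanR (cexp (2 * π * I * (-(τ : ℂ)⁻¹)))} :
        Set ℂ) ≤
      adjoin ℚ (insert (cexp (2 * π * I * (-(τ : ℂ)⁻¹)))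
        ({2 * (π : ℂ) * I, (τ : ℂ), cexp (2 * π * I * τ), ramanujanP (cexp (2 * π * I * τ)),
          ramanujanQ (cexp (2 * π * I * τ)), ramanujanR (cexp (2 * π * I * τ))} : Set ℂ)) := by
  set K := adjoin ℚ (insert (cexp (2 * π * I * (-(τ : ℂ)⁻¹)))
        ({2 * (π : ℂ) * I, (τ : ℂ), cexp (2 * π * I * τ), ramanujanP (cexp (2 * π * I * τ)),
          ramanujanQ (cexp (2 * π * I * τ)), ramanujanR (cexp (2 * π * I * τ))} : Set ℂ)) with hK
  have hsub : insert (cexp (2 * π * I * (-(τ : ℂ)⁻¹)))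
        ({2 * (π : ℂ) * I, (τ : ℂ), cexp (2 * π * I * τ), ramanujanP (cexp (2 * π * I * τ)),
          ramanujanQ (cexp (2 * π * I * τ)), ramanujanR (cexp (2 * π * I * τ))} : Set ℂ) ⊆ K :=
    subset_adjoin ℚ _
  have hq' : cexp (2 * π * I * (-(τ : ℂ)⁻¹)) ∈ K := hsub (Set.mem_insert _ _)
  have h2pi : 2 * (π : ℂ) * I ∈ K := hsub (by simp)
  have hτ : (τ : ℂ) ∈ K := hsub (by simp)
  have hq : cexp (2 * π * I * τ) ∈ K := hsub (by simp)
  have hP : ramanujanP (cexp (2 * π * I * τ)) ∈ K := hsub (by simp)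
  have hQ : ramanujanQ (cexp (2 * π * I * τ)) ∈ K := hsub (by simp)
  have hR : ramanujanR (cexp (2 * π * I * τ)) ∈ K := hsub (by simp)
  have hP' : ramanujanP (cexp (2 * π * I * (-(τ : ℂ)⁻¹))) ∈ K := by
    rw [ramanujanP_partner]
    exact add_mem (mul_mem (pow_mem hτ 2) hP)
      (mul_mem (mul_mem (ofNat_mem K 12) hτ) (inv_mem h2pi))
  have hQ' : ramanujanQ (cexp (2 * π * I * (-(τ : ℂ)⁻¹))) ∈ K := by
    rw [ramanujanQ_partner]
    exact mul_mem (pow_mem hτ 4) hQ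
  have hR' : ramanujanR (cexp (2 * π * I * (-(τ : ℂ)⁻¹))) ∈ K := by
    rw [ramanujanR_partner]
    exact mul_mem (pow_mem hτ 6) hR
  refine adjoin_le_iff.mpr ?_
  intro x hx
  simp only [Set.mem_insert_iff, Set.mem_singleton_iff] at hx
  rcases hx with rfl | rfl | rfl | rfl | rfl | rfl | rfl | rfl <;> assumption

/-- **Decoder count**: `trdeg ℚ(q, P, Q, R, q', P', Q', R') ≤ trdeg ℚ(2πi, τ, q, P, Q, R) + 1`. -/
theorem trdeg_twoNome_le (τ : ℍ) :
    Algebra.trdeg ℚ ↥(adjoin ℚ ({cexp (2 * π * I * τ), ramanujanP (cexp (2 * π * I * τ)),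
        ramanujanQ (cexp (2 * π * I * τ)), ramanujanR (cexp (2 * π * I * τ)),
        cexp (2 * π * I * (-(τ : ℂ)⁻¹)), ramanujanP (cexp (2 * π * I * (-(τ : ℂ)⁻¹))),
        ramanujanQ (cexp (2 * π * I * (-(τ : ℂ)⁻¹))), ramanujanR (cexp (2 * π * I * (-(τ : ℂ)⁻¹)))} :
        Set ℂ)) ≤
      Algebra.trdeg ℚ ↥(adjoin ℚ ({2 * (π : ℂ) * I, (τ : ℂ), cexp (2 * π * I * τ),
          ramanujanP (cexp (2 * π * I * τ)), ramanujanQ (cexp (2 * π * I * τ)),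
          ramanujanR (cexp (2 * π * I * τ))} : Set ℂ)) + 1 := by
  have hle := adjoin_twoNome_le τ
  exact (trdeg_le_of_injective (inclusion hle) (inclusion_injective hle)).trans
    (Literature.NumberTheory.Transcendental.trdeg_adjoin_insert_le _ _)

/-- `6 ≤ t + 1 → 5 ≤ t` in `Cardinal` (trivial for infinite `t`, arithmetic for finite `t`). -/
theorem five_le_of_six_le_add_one {t : Cardinal} (h : (6 : Cardinal) ≤ t + 1) : (5 : Cardinal) ≤ t := by
  by_cases hinf : Cardinal.aleph0 ≤ t
  · exact le_trans (Cardinal.natCast_lt_aleph0 (n := 5)).le hinf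
  · obtain ⟨n, rfl⟩ := Cardinal.lt_aleph0.1 (not_le.1 hinf)
    have h' : (6 : ℕ) ≤ n + 1 := by exact_mod_cast h
    have h'' : (5 : ℕ) ≤ n := by omega
    exact_mod_cast h''

/-! ## Transfer: the two-nome statement implies the crux -/

/-- **Transfer `TwoNomeS → TateLocusGPCOne`** (S-decoder; card `s-dual-second-cusp`): if for every
non-quadratic `τ ∈ ℍ` the eight cusp-values `(q, P, Q, R)(e^{2πiτ}) ∪ (q, P, Q, R)(e^{−2πi/τ})` have
transcendence degree `≥ 6`, then `5 ≤ trdeg ℚ(2πi, τ, q, P, Q, R)`. -/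
theorem tateLocusGPCOne_of_twoNome
    (h : ∀ τ : ℂ, 0 < τ.im → (∀ b c : ℚ, τ ^ 2 + (b : ℂ) * τ + (c : ℂ) ≠ 0) →
      (6 : Cardinal) ≤ Algebra.trdeg ℚ ↥(adjoin ℚ ({cexp (2 * π * I * τ),
        ramanujanP (cexp (2 * π * I * τ)), ramanujanQ (cexp (2 * π * I * τ)),
        ramanujanR (cexp (2 * π * I * τ)), cexp (2 * π * I * (-τ⁻¹)),
        ramanujanP (cexp (2 * π * I * (-τ⁻¹))), ramanujanQ (cexp (2 * π * I * (-τ⁻¹))),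
        ramanujanR (cexp (2 * π * I * (-τ⁻¹)))} : Set ℂ))) :
    Summit.Schanuel.Schanuel.Theses.TateNomes.TateLocusGPCOne := by
  intro τ hτ hnq
  exact five_le_of_six_le_add_one ((h τ hτ hnq).trans (trdeg_twoNome_le ⟨τ, hτ⟩))

end Summit.Schanuel.Schanuel.Theorems.TateNomesTateLocusGPCOne

end
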